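import Literature.MathematicalPhysics.QuantumManyBody.BoseEinsteinCondensation
import Mathlib.Topology.Connected.PathConnected
import Mathlib.Analysis.Convex.Basic
import HarnessLib

/-!
# Crux `GroundStateRigidity` (stmt-AtomisticToContinuum-9072), line `Sketch`:
# tools for the registered stub `stub_parkingTwoB` (parking lemma)

Supports (does not close) stmt-AtomisticToContinuum-9072; auxiliary file for the registered stub
`stub_parkingTwoB` (Stub D) of line Sketch (skeleton v9). Elementary geometry of the free region
`F_b(N, L) = {Z ∈ Λ_L^N : |zᵢ - zⱼ| > b ∀ i ≠ j}` of `N` labelled hard spheres in the open cube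
`Λ_L = (0, L)³`:

* `ParkingTwoB.joinedIn_update`: moving ONE particle along a straight segment, the others fixed,
  stays in `F_b` as soon as the moving point stays in the box and `> b` away from the others;
* `ParkingTwoB.joinedIn_smul`: the homothety `t ↦ (1 - t/2) X` joins a configuration with all
  pairs `> 2b` to `X/2` (all coordinates `< L/2`, all pairs `> b`) inside `F_b`;
* the canonical parking lattice in the empty upper half `{x⁰ > L/2}` (local notation `spot`):
  label value `n` sits at height `L/2 + 6b + 4b·⌊⌊n/P⌋/P⌋`, horizontal position
  `(4b(⌊n/P⌋ mod P + 1), 4b(n mod P + 1))`; its box bounds (`ParkingTwoB.spot_bounds`) and the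
  two separation facts used by the parking moves: elevator shafts at horizontal offset `2b` from
  the columns are `> b` away from every spot (`ParkingTwoB.lt_dist_spot_of_shaft`); a point of
  the segment from the shaft into a spot is `> b` away from every OTHER spot
  (`ParkingTwoB.lt_dist_spot_of_ne`, mixed-radix injectivity `ParkingTwoB.radix_inj`).

All distance bounds are single-coordinate bounds `|x k - y k| ≤ dist x y`, except the vertical
lift of the highest particle, where `dist² = Σ (Δ_k)²` is monotone in the vertical gap
(`ParkingTwoB.dist_le_dist_of_lift`). No definitions: the free region and the spots are written
out (local notations `Free(N, L, b)`, `spot(L, b, P, n)`).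
-/

noncomputable section

open MeasureTheory Filter Set Metric
open scoped ENNReal NNReal Topology

namespace Summit.AtomisticToContinuum.BoseEinsteinCondensation.Theorems.GroundStateRigidity

open Literature.MathematicalPhysics.QuantumManyBody.BoseGas

/-- Local notation: the free region `F_b(N, L) = {Z ∈ Λ_L^N : |zᵢ - zⱼ| > b ∀ i ≠ j}` of `N`
labelled hard spheres in the open cube (the set-builder of the skeleton, not a definition). -/
local notation3 "Free(" N ", " L ", " b ")" =>
  {Z : Config N | Z ∈ boxN N L ∧ ∀ i j : Fin N, i ≠ j → b < dist (Z i) (Z j)}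

/-- Local notation: the parking spot of label value `n` for `P` columns per horizontal direction —
height `L/2 + 6b + 4b⌊⌊n/P⌋/P⌋`, horizontal coordinates `4b(⌊n/P⌋ mod P + 1)` and
`4b(n mod P + 1)` (an explicit point of `ℝ³`, not a definition). -/
local notation3 "spot(" L ", " b ", " P ", " n ")" =>
  (!₂[L / 2 + 6 * b + 4 * b * ((n / P / P : ℕ) : ℝ), 4 * b * (((n / P % P : ℕ) : ℝ) + 1),
    4 * b * (((n % P : ℕ) : ℝ) + 1)] : Space)

namespace ParkingTwoB

variable {N : ℕ}

/-! ### Points, segments and coordinates in `ℝ³` -/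

/-- Coordinates of the point with prescribed coordinates. [folklore] -/
@[simp] theorem mk_apply_zero (x y z : ℝ) : (!₂[x, y, z] : Space) 0 = x := rfl

/-- Coordinates of the point with prescribed coordinates. [folklore] -/
@[simp] theorem mk_apply_one (x y z : ℝ) : (!₂[x, y, z] : Space) 1 = y := rfl

/-- Coordinates of the point with prescribed coordinates. [folklore] -/
@[simp] theorem mk_apply_two (x y z : ℝ) : (!₂[x, y, z] : Space) 2 = z := rfl

/-- Membership in the open box `Λ_L = (0, L)³`, coordinatewise. [folklore] -/
theorem mem_box_iff {L : ℝ} {x : Space} :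
    x ∈ box L ↔ x 0 ∈ Ioo 0 L ∧ x 1 ∈ Ioo 0 L ∧ x 2 ∈ Ioo 0 L := by
  simp [box, Fin.forall_fin_succ]

/-- Coordinates along the segment `t ↦ p + t (q - p)`. [folklore] -/
theorem segment_apply (p q : Space) (t : ℝ) (k : Fin 3) :
    (p + t • (q - p)) k = p k + t * (q k - p k) := by
  simp [smul_eq_mul]

/-- Along a segment a coordinate stays between its endpoint values (increasing case). [folklore] -/
theorem segment_apply_mem_Icc {p q : Space} {t : ℝ} (ht : t ∈ Icc (0 : ℝ) 1) {k : Fin 3}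
    (hk : p k ≤ q k) : (p + t • (q - p)) k ∈ Icc (p k) (q k) := by
  rw [segment_apply]
  constructor <;> nlinarith [ht.1, ht.2]

/-- The open box is convex: a segment between two of its points stays inside. [folklore] -/
theorem segment_mem_box {L : ℝ} {p q : Space} (hp : p ∈ box L) (hq : q ∈ box L) {t : ℝ}
    (ht : t ∈ Icc (0 : ℝ) 1) : p + t • (q - p) ∈ box L := by
  intro k
  rw [segment_apply]
  simpa [smul_eq_mul] using (convex_Ioo (0 : ℝ) L).add_smul_sub_mem (hp k) (hq k) ht

/-- A single coordinate gap bounds the Euclidean distance from below. [folklore] -/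
theorem lt_dist_of_lt_abs_sub {x y : Space} {b : ℝ} (k : Fin 3) (h : b < |x k - y k|) :
    b < dist x y := by
  have h' := PiLp.dist_apply_le x y k
  rw [Real.dist_eq] at h'
  exact h.trans_le h'

/-- Raising the first coordinate of the higher of two points does not decrease their distance
(`dist² = Σ_k (Δ_k)²` and the vertical gap grows). [folklore] -/
theorem dist_le_dist_of_lift {x y m : Space} (h1 : m 1 = x 1) (h2 : m 2 = x 2) (hyx : y 0 ≤ x 0)
    (hxm : x 0 ≤ m 0) : dist x y ≤ dist m y := by
  have hx := EuclideanSpace.dist_sq_eq x y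
  have hm := EuclideanSpace.dist_sq_eq m y
  simp only [Fin.sum_univ_three, Real.dist_eq, sq_abs] at hx hm
  refine le_of_pow_le_pow_left₀ two_ne_zero dist_nonneg ?_
  rw [hx, hm, h1, h2]
  nlinarith [mul_nonneg (sub_nonneg.2 hxm) (sub_nonneg.2 hyx), sq_nonneg (m 0 - x 0)]

/-- **Lattice separation.** For naturals `m, n` and an offset `0 ≤ s ≤ 2b`, the gap
`|4b(m+1) + s - 4b(n+1)|` exceeds `b` as soon as `m ≠ n` or `s > b`. [folklore] -/
theorem lt_abs_lattice {b : ℝ} (hb : 0 < b) (m n : ℕ) {s : ℝ} (hs0 : 0 ≤ s) (hs1 : s ≤ 2 * b)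
    (h : m ≠ n ∨ b < s) : b < |4 * b * ((m : ℝ) + 1) + s - 4 * b * ((n : ℝ) + 1)| := by
  rcases lt_trichotomy m n with hmn | rfl | hnm
  · have hle : (m : ℝ) + 1 ≤ n := by exact_mod_cast hmn
    rw [lt_abs]
    right
    nlinarith
  · have hs : b < s := h.resolve_left fun h' => h' rfl
    rw [lt_abs]
    left
    linarith
  · have hle : (n : ℝ) + 1 ≤ m := by exact_mod_cast hnm
    rw [lt_abs]
    left
    nlinarith

/-! ### Moving one particle along a segment -/

/-- **One particle moves, the others stay.** If `Z` with particle `i` placed at `p` lies in the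
free region, `q` lies in the open box, and along the segment from `p` to `q` the moving point stays
farther than `b` from every other particle, then the segment move joins the two configurations
inside the free region (the box is convex; the other pairs do not move). [folklore] -/
theorem joinedIn_update {L b : ℝ} {Z : Config N} {i : Fin N} {p q : Space}
    (hZ : Function.update Z i p ∈ Free(N, L, b)) (hq : q ∈ box L)
    (hsep : ∀ t ∈ Icc (0 : ℝ) 1, ∀ j : Fin N, j ≠ i → b < dist (p + t • (q - p)) (Z j)) :
    JoinedIn Free(N, L, b) (Function.update Z i p) (Function.update Z i q) := by
  have hbox : ∀ j, Function.update Z i p j ∈ box L := hZ.1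
  have hp : p ∈ box L := by simpa using hbox i
  refine JoinedIn.ofLine (f := fun t : ℝ => Function.update Z i (p + t • (q - p))) ?_ ?_ ?_ ?_
  · exact (continuous_const.update i (by fun_prop)).continuousOn
  · simp
  · simp
  · rintro _ ⟨t, ht, rfl⟩
    dsimp only
    refine ⟨fun j => ?_, fun j j' hjj' => ?_⟩
    · by_cases hj : j = i
      · rw [hj, Function.update_self]
        exact segment_mem_box hp hq ht
      · simpa [Function.update_of_ne hj] using hbox j
    · by_cases hj : j = i <;> by_cases hj' : j' = i
      · exact absurd (hj.trans hj'.symm) hjj'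
      · rw [hj, Function.update_self, Function.update_of_ne hj']
        exact hsep t ht j' hj'
      · rw [hj', Function.update_self, Function.update_of_ne hj, dist_comm]
        exact hsep t ht j hj
      · rw [Function.update_of_ne hj, Function.update_of_ne hj']
        have h2 := hZ.2 j j' hjj'
        rwa [Function.update_of_ne hj, Function.update_of_ne hj'] at h2

/-! ### Step 0: the homothety `X ↦ X/2` -/

/-- **Uniform compression.** If all pairs of `X ∈ Λ_L^N` are `> 2b` apart, the homothety
`t ↦ (1 - t/2) • X`, `t ∈ [0,1]`, joins `X` to `X/2` inside the free region `F_b(N, L)`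
(coordinates shrink within `(0, L)`, pair distances shrink by at most `1/2`). [folklore] -/
theorem joinedIn_smul {L b : ℝ} {X : Config N} (hXbox : X ∈ boxN N L)
    (hX2 : ∀ i j : Fin N, i ≠ j → 2 * b < dist (X i) (X j)) :
    JoinedIn Free(N, L, b) X ((1 / 2 : ℝ) • X) := by
  refine JoinedIn.ofLine (f := fun t : ℝ => (1 - t / 2) • X) (by fun_prop) (by simp)
    (by norm_num) ?_
  rintro _ ⟨t, ht, rfl⟩
  dsimp only
  have hc0 : (1 / 2 : ℝ) ≤ 1 - t / 2 := by linarith [ht.2]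
  have hc1 : 1 - t / 2 ≤ 1 := by linarith [ht.1]
  have hbox : ∀ i k, X i k ∈ Ioo 0 L := hXbox
  refine ⟨fun i k => ?_, fun i j hij => ?_⟩
  · have hik := hbox i k
    simp only [Pi.smul_apply, PiLp.smul_apply, smul_eq_mul]
    exact ⟨by nlinarith [hik.1], by nlinarith [hik.1, hik.2]⟩
  · rw [Pi.smul_apply, Pi.smul_apply, dist_smul₀, Real.norm_eq_abs, abs_of_pos (by linarith)]
    have h := hX2 i j hij
    have h' := mul_le_mul_of_nonneg_right hc0 (dist_nonneg : 0 ≤ dist (X i) (X j))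
    linarith

/-! ### The parking lattice -/

/-- Mixed-radix injectivity: `n` is determined by `⌊⌊n/P⌋/P⌋`, `⌊n/P⌋ mod P` and `n mod P`.
[folklore] -/
theorem radix_inj {P m n : ℕ} (h0 : m / P / P = n / P / P) (h1 : m / P % P = n / P % P)
    (h2 : m % P = n % P) : m = n := by
  have key : m / P = n / P := by
    rw [← Nat.div_add_mod (m / P) P, ← Nat.div_add_mod (n / P) P, h0, h1]
  rw [← Nat.div_add_mod m P, ← Nat.div_add_mod n P, key, h2]

/-- **Box bounds of the spots.** With `4b(P+1) ≤ L`, `8b(A+1) ≤ L` and `n < P²A`: the height of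
spot `n` lies in `[L/2 + 6b, L - 2b]` and its horizontal coordinates in `[4b, L - 4b]`. [folklore] -/
theorem spot_bounds {L b : ℝ} {P A n : ℕ} (hb : 0 < b) (hP : 4 * b * ((P : ℝ) + 1) ≤ L)
    (hA : 8 * b * ((A : ℝ) + 1) ≤ L) (hP0 : 0 < P) (hn : n < P * P * A) :
    L / 2 + 6 * b ≤ spot(L, b, P, n) 0 ∧ spot(L, b, P, n) 0 + 2 * b ≤ L ∧
      4 * b ≤ spot(L, b, P, n) 1 ∧ spot(L, b, P, n) 1 + 4 * b ≤ L ∧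
      4 * b ≤ spot(L, b, P, n) 2 ∧ spot(L, b, P, n) 2 + 4 * b ≤ L := by
  have ha : n / P / P < A := by
    rw [Nat.div_lt_iff_lt_mul hP0, Nat.div_lt_iff_lt_mul hP0]
    calc n < P * P * A := hn
      _ = A * P * P := by ring
  have hp : n / P % P < P := Nat.mod_lt _ hP0
  have hq : n % P < P := Nat.mod_lt _ hP0
  have ha' : ((n / P / P : ℕ) : ℝ) + 1 ≤ A := by exact_mod_cast ha
  have hp' : ((n / P % P : ℕ) : ℝ) + 1 ≤ P := by exact_mod_cast hp
  have hq' : ((n % P : ℕ) : ℝ) + 1 ≤ P := by exact_mod_cast hq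
  have ha0 : (0 : ℝ) ≤ ((n / P / P : ℕ) : ℝ) := Nat.cast_nonneg _
  have hp0 : (0 : ℝ) ≤ ((n / P % P : ℕ) : ℝ) := Nat.cast_nonneg _
  have hq0 : (0 : ℝ) ≤ ((n % P : ℕ) : ℝ) := Nat.cast_nonneg _
  have h4b : (0 : ℝ) ≤ 4 * b := by linarith
  have ha'' := mul_le_mul_of_nonneg_left ha' h4b
  have hp'' := mul_le_mul_of_nonneg_left hp' h4b
  have hq'' := mul_le_mul_of_nonneg_left hq' h4b
  have ha0' := mul_nonneg h4b ha0
  have hp0' := mul_nonneg h4b hp0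
  have hq0' := mul_nonneg h4b hq0
  rw [mk_apply_zero, mk_apply_one, mk_apply_two]
  refine ⟨?_, ?_, ?_, ?_, ?_, ?_⟩ <;> linarith

/-- The spots lie in the open box. [folklore] -/
theorem spot_mem_box {L b : ℝ} {P A n : ℕ} (hb : 0 < b) (hP : 4 * b * ((P : ℝ) + 1) ≤ L)
    (hA : 8 * b * ((A : ℝ) + 1) ≤ L) (hP0 : 0 < P) (hn : n < P * P * A) :
    spot(L, b, P, n) ∈ box L := by
  obtain ⟨h0, h0', h1, h1', h2, h2'⟩ := spot_bounds hb hP hA hP0 hn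
  have hL : 0 < L := by linarith
  rw [mem_box_iff]
  exact ⟨⟨by linarith, by linarith⟩, ⟨by linarith, by linarith⟩, ⟨by linarith, by linarith⟩⟩

/-- **Shaft clearance.** A point at offset `2b` in coordinate `1` from a column is `> b` away from
every spot: the columns are `4b` apart, so the gap in coordinate `1` is `4b·|m' - n' + 1/2| ≥ 2b`.
[folklore] -/
theorem lt_dist_spot_of_shaft {L b : ℝ} {P : ℕ} (hb : 0 < b) (m n : ℕ) {x : Space}
    (h1 : x 1 = spot(L, b, P, m) 1 + 2 * b) : b < dist x spot(L, b, P, n) := by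
  refine lt_dist_of_lt_abs_sub 1 ?_
  rw [h1, mk_apply_one, mk_apply_one]
  exact lt_abs_lattice hb (m / P % P) (n / P % P) (s := 2 * b) (by linarith) le_rfl
    (Or.inr (by linarith))

/-- **Parking clearance.** A point on the segment from the shaft into spot `m` (same height and
same coordinate `2` as the spot, coordinate `1` at most `2b` above it) is `> b` away from every
other spot `n ≠ m`: different level or different second column index give a gap `≥ 4b` in that
coordinate, otherwise the first column indices differ (mixed-radix injectivity) and the gap in
coordinate `1` is `≥ 2b`. [folklore] -/
theorem lt_dist_spot_of_ne {L b : ℝ} {P : ℕ} (hb : 0 < b) {m n : ℕ} (hmn : m ≠ n) {x : Space}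
    (h0 : x 0 = spot(L, b, P, m) 0) (h2 : x 2 = spot(L, b, P, m) 2) {s : ℝ} (hs0 : 0 ≤ s)
    (hs1 : s ≤ 2 * b) (h1 : x 1 = spot(L, b, P, m) 1 + s) : b < dist x spot(L, b, P, n) := by
  by_cases ha : m / P / P = n / P / P
  · by_cases hq : m % P = n % P
    · have hp : m / P % P ≠ n / P % P := fun hp => hmn (radix_inj ha hp hq)
      refine lt_dist_of_lt_abs_sub 1 ?_
      rw [h1, mk_apply_one, mk_apply_one]
      exact lt_abs_lattice hb _ _ hs0 hs1 (Or.inl hp)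
    · refine lt_dist_of_lt_abs_sub 2 ?_
      rw [h2, mk_apply_two, mk_apply_two]
      have key := lt_abs_lattice hb (m % P) (n % P) le_rfl (by linarith) (Or.inl hq)
      convert key using 2
      ring
  · refine lt_dist_of_lt_abs_sub 0 ?_
    rw [h0, mk_apply_zero, mk_apply_zero]
    have key := lt_abs_lattice hb (m / P / P) (n / P / P) le_rfl (by linarith) (Or.inl ha)
    convert key using 2
    ring

end ParkingTwoB

end Summit.AtomisticToContinuum.BoseEinsteinCondensation.Theorems.GroundStateRigidity

end
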